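import Summits.Schanuel.Schanuel.Cruxes.AclSubsetLogFreeCore.Sketch
import Summits.Schanuel.Schanuel.Cruxes.AclSubsetLogFreeCore.SketchIdeator3
import Literature.NumberTheory.Transcendental.GammaFieldsEcl

/-!
# Crux-triage r1-3 (gen 2) scratch: the ASSEMBLY stubs of the merged EAC line are bookkeeping

Both EAC cards (`eac-extends-core-automorphisms`, ideator 1: `CardTwoAssembly`;
`eac-prime-model-over-core`, ideator 3: `Sketch.CardA_Assembly`) claim their assembly is
"three lines: ∅-definable sets are invariant under E-automorphisms of ℂ".  This file PROVES both
assembly statements exactly as typed in the published sketches (imported, not restated; no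
dependence on the moving `Disproof.lean`), plus the literal identity of the two cards' zeroth/first lemma, and a non-vacuity check (`ln 2 ∈ ecl ∅`).
Evidence for the crux item; not a Theorems/ landing (positive lemmas travel as evidence).
-/

noncomputable section

set_option linter.dupNamespace false

open FirstOrder FirstOrder.Language Set
open Literature.ModelTheory.ExponentialFields Literature.NumberTheory.Transcendental

namespace Summit.Schanuel.Schanuel.Cruxes.AclSubsetLogFreeCore.Triage3

/-- The `L_exp`-structure on `ℂ` interprets `exp` by `Complex.exp` (by `rfl`). -/
@[simp] theorem expRing_exp_apply' (x : ℂ) :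
    (Literature.ModelTheory.ExponentialFields.ExponentialRing.exp x : ℂ) = Complex.exp x := rfl

/-- A ring automorphism of `ℂ` commuting with `exp` is an automorphism of the `L_exp`-structure. -/
def lequivOfExpComm (σ : ℂ ≃+* ℂ) (hσ : ∀ z, σ (Complex.exp z) = Complex.exp (σ z)) :
    Language.expRing.Equiv ℂ ℂ where
  toEquiv := σ.toEquiv
  map_fun' := fun {n} f x => by
    cases f
    · simp
    · simp
    · simp
    · simp
    · simp
    · simp [hσ]
  map_rel' := fun {n} r x => by cases r

/-- `∅`-definable sets of tuples are invariant under exp-commuting ring automorphisms. -/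
theorem comp_mem_of_definable (σ : ℂ ≃+* ℂ) (hσ : ∀ z, σ (Complex.exp z) = Complex.exp (σ z))
    {α : Type*} {s : Set (α → ℂ)} (hs : (∅ : Set ℂ).Definable Language.expRing s)
    {v : α → ℂ} (hv : v ∈ s) : σ ∘ v ∈ s := by
  obtain ⟨φ, rfl⟩ := Set.empty_definable_iff.1 hs
  have h := FirstOrder.Language.StrongHomClass.realize_formula (lequivOfExpComm σ hσ) φ (v := v)
  exact h.2 hv

/-- `∅`-definable subsets of `ℂ` are invariant under exp-commuting ring automorphisms. -/
theorem mem_of_definable₁ (σ : ℂ ≃+* ℂ) (hσ : ∀ z, σ (Complex.exp z) = Complex.exp (σ z))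
    {s : Set ℂ} (hs : Set.Definable₁ (∅ : Set ℂ) Language.expRing s) {a : ℂ} (ha : a ∈ s) :
    σ a ∈ s :=
  comp_mem_of_definable σ hσ hs (v := fun _ : Fin 1 => a) ha

/-- The two EAC cards' entry lemmas are literally the same statement. -/
theorem eacAclSubsetEcl_iff : EacAclSubsetEcl ↔ Sketch.AclSubsetEclOfEAC := Iff.rfl

/-- **Ideator 3's assembly** `CardA_Assembly : AclSubsetEclOfEAC → IsExpAlgClosed ℂ →
CoreRigidity → AclSubsetLogFreeCore`, proved: the `Aut(ℂ_exp)`-orbit of a point of a finite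
`∅`-definable set lies in that set. -/
theorem cardA_assembly_holds : Sketch.CardA_Assembly := by
  intro hAcl hEAC hRig a ha
  obtain ⟨s, hsfin, hsdef, has⟩ := ha
  refine hRig a (hAcl hEAC ⟨s, hsfin, hsdef, has⟩) (hsfin.subset ?_)
  rintro b ⟨σ, hσ, rfl⟩
  exact mem_of_definable₁ σ hσ hsdef has

/-- **Ideator 1's assembly** `CardTwoAssembly : EacExtendsCoreAutomorphisms → EacAclSubsetEcl →
CoreOrbitsInfinite → IsExpAlgClosed ℂ → AclSubsetLogFreeCore`, proved. -/
theorem cardTwoAssembly_holds : CardTwoAssembly := by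
  intro hExt hAcl hOrb hEAC a ha
  obtain ⟨s, hsfin, hsdef, has⟩ := ha
  have hacl : a ∈ ecl (∅ : Set ℂ) := hAcl hEAC ⟨s, hsfin, hsdef, has⟩
  by_contra hnot
  have hinf := hOrb ⟨a, hacl⟩ hnot
  refine hinf (hsfin.subset ?_)
  rintro b ⟨θ, rfl⟩
  obtain ⟨ρ, hρ⟩ := hExt hEAC θ
  rw [← hρ]
  have hρexp : ∀ z, ρ.toRingEquiv (Complex.exp z) = Complex.exp (ρ.toRingEquiv z) :=
    fun z => ρ.map_exp z
  exact mem_of_definable₁ ρ.toRingEquiv hρexp hsdef has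

/-- Non-vacuity of the core objects: `ln 2 ∈ ecl ∅` (so `C₀ = ecl ∅` is not `ℚ̄`-trivial on the
log sector the cards discuss). -/
example : (Real.log 2 : ℂ) ∈ ecl (∅ : Set ℂ) := by
  apply GammaField.mem_ecl_of_exp_mem
  have h : (Literature.ModelTheory.ExponentialFields.ExponentialRing.exp (Real.log 2 : ℂ) : ℂ) =
      (1 : ℂ) + 1 := by
    show Complex.exp _ = _
    rw [← Complex.ofReal_exp, Real.exp_log two_pos]; norm_num
  rw [h]
  exact Khovanskii.add_mem_ecl (Khovanskii.one_mem_ecl _) (Khovanskii.one_mem_ecl _)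

/-- SHARPEN note for `CoreRigidity` (ideator 3), made precise: as typed over exp-commuting
`ℂ ≃+* ℂ`, the stub is hostage to the size of `Aut(ℂ_exp)` — if the only such automorphisms are
`id` and `conj` (unrefuted today), `CoreRigidity` collapses to `ecl ∅ ⊆ C_EA` (false under SC:
`ln 2`). Hence the merged line should state the residue over `Aut_E(C₀)` (ideator 1's
`CoreOrbitsInfinite`), where EAC + extension makes the two forms equivalent. -/
theorem coreRigidity_collapse_of_rigid
    (hrig : ∀ σ : ℂ ≃+* ℂ, (∀ z : ℂ, σ (Complex.exp z) = Complex.exp (σ z)) →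
      (∀ z, σ z = z) ∨ (∀ z, σ z = (starRingEnd ℂ) z))
    (h : Sketch.CoreRigidity) : ecl (∅ : Set ℂ) ⊆ (Sketch.logFreeCore : Set ℂ) := by
  intro a ha
  refine h a ha ((Set.toFinite ({a, (starRingEnd ℂ) a} : Set ℂ)).subset ?_)
  rintro b ⟨σ, hσ, rfl⟩
  rcases hrig σ hσ with h1 | h2
  · exact Or.inl (h1 a)
  · exact Or.inr (h2 a)

end Summit.Schanuel.Schanuel.Cruxes.AclSubsetLogFreeCore.Triage3
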